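import Summits.BirchSwinnertonDyer.Rank1Residual.X2.RankOneLinks
import HarnessLib

/-!
# Class X2, rank `1` (sub-cell X2c): the whole chain at ONE pair — links ⟹ `BSD(E,p)`
# (cell `b2b-bsdres`, unit `b2b-bsdres-eisenstein-p2`, gen 2)

HONEST FRAMING (run/shared/lean/b2b/bsd-rank1-residual/, verbatim in every file): the goal of the
cell is to DELETE the COMBINATION-SHAPED residual classes of the Birch–Swinnerton-Dyer formula for
ALL analytic-rank `≤ 1` elliptic curves over `ℚ` — "full BSD formula for every rank `≤ 1` curve in
class `C`" assembled STRICTLY from published theorems — so that the rank-`≤ 1` remainder becomes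
exactly the CONSTRUCTION-SHAPED classes, which are TYPED (missing-input `Prop`s), NOT attempted.
This is not "finishing BSD". Research routes; no claim beyond stated classes. X2c stays
CONSTRUCTION-SHAPED; an announced preprint (Keller–Yin) enters ONLY as explicitly labelled
hypotheses (here: two equations on a `Λ`-adic shadow), never as a theorem.

ONE THEOREM (no definition, no new named fact): `bsdp_of_cellC_of_not_gvPar_of_shadowLinks` — for a
sub-cell-X2c pair `(E,p)` with `¬GVPar` (ψ even) and explicit Heegner data (`K` imaginary quadratic
with `d_K < −4`, the Heegner hypothesis for `N_E` and for `p`, `L(E^{d_K},1) ≠ 0`; a parametrisation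
datum with `p ∤ c` and its Heegner point `P`; a globally minimal model of the twist with the two
decidable transport values), Miller's `BSD(E,p)` follows from:
* PUBLISHED named facts (binders): Gross–Zagier, Kolyvagin, GZK over `ℚ`, modularity, and — for
  the rank-`0` partner `E^{d_K}`, which lies in the CLOSED sub-cell X2a — Greenberg–Vatsal at `p ‖ N`
  (`lambdaMu_multiplicative_of_gvPar`, referee flag `GV00-mult-asserted`, = Wuthrich Thm. 16 +
  Greenberg 1999 Prop. 5.10 + `lambda_muAnal_multiplicative_of_gvPar` by p201441), Wuthrich 2014
  Thm. 16, Stein–Wuthrich 2013, Greenberg–Stevens;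
* the four `Λ`-adic LINKS on a shadow `S` (`X11b.LambdaAdicShadow`, valuations only): (IMC)
  Keller–Yin arXiv:2402.12781v2 Thm. 5.0.4 [PREPRINT]; (CTL) Keller–Yin Thm. 7.0.6 / Prop. 7.0.5
  [PREPRINT; JSW 2017 §3's (sst) setting, which includes multiplicative `p`] with the multiplicative
  local index of Castella 2018 §2 [PUB]; (BDP) Castella JIMJ 17 (2018) Thm. 2.10–2.11 + Mazur 1978
  [PUB, `p ≥ 5`, split]; (TAM) vacuous for a Heegner field of the conductor;
* the Tamagawa-over-`K` transport value `ord_p ∏_w c_w(E/K) = 2·ord_p ∏_ℓ c_ℓ(E/ℚ)`;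
* and the kernel: `indexIdentityAt_of_shadowLinks` (p202051) + `bsdp_of_cellC_of_not_gvPar_of_indexIdentityAt`
  (p201343: multr1-p2's exact descent `X11b.bsdp_of_indexIdentityAt`, p199961).
So at a ψ-even X2c pair with `p ≥ 5` split (35 census pairs) the ONLY non-published inputs are the
two Keller–Yin equations on the shadow; at `p = 3` the (BDP) equation is outside print as well.
Nothing is asserted; no label changes.

References: [KellerYin2024] (PRE) Thm. 5.0.4, Thm. 7.0.6, Prop. 7.0.5; [Castella2018] §2 (proof of
Thm. 2.3), Thm. 3.2, §5; [Castella2018Exceptional] Thm. 2.10–2.11; [JetchevSkinnerWan2017] §3,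
§7.4; [CastellaEtAl2021] Thm. 5.3.1; [GreenbergVatsal2000]; [Miller2011LMS] Def. 1.1.
-/

set_option autoImplicit false

noncomputable section

open scoped Classical MatrixGroups ModularForm

open CongruenceSubgroup WeierstrassCurve NumberField Literature.NumberTheory.EllipticCurves
  Literature.NumberTheory.EllipticCurves.ModularForms
  Literature.NumberTheory.EllipticCurves.Rank1Residual
  Literature.NumberTheory.EllipticCurves.Rank1Residual.Typed
  Literature.NumberTheory.EllipticCurves.GreenbergVatsal2000
  Literature.NumberTheory.EllipticCurves.Wuthrich2014
  Literature.NumberTheory.EllipticCurves.SteinWuthrich2013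

namespace Summit.BirchSwinnertonDyer.Rank1Residual.X2

/-- **X2c ∧ ψ even, one pair, end to end: the four `Λ`-adic links ⟹ `BSD(E,p)`.** Hypotheses:
PUBLISHED named facts (`hGV` = Greenberg–Vatsal at `p ‖ N` [flag `GV00-mult-asserted`], `hWu`,
`hJs`, `hJn`, `hHs`, `hHn`, `hpar`, `hGS` for the rank-`0` partner in X2a; `hGZ`, `hKo`, `hGZK`, `hmod`);
the pair (`CellC`, `¬GVPar`); Heegner data (`K` with `d_K < −4`, Heegner hypothesis for the level `N`
and for `p`, `L(E^{d_K},1) ≠ 0`, datum `Dt` with `p ∤ c`, Heegner point `P`); a globally minimal twist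
model with the two decidable values; a shadow `S` with (IMC) [Keller–Yin Thm. 5.0.4, PRE], (BDP)
[Castella JIMJ 2018 Thm. 2.11 + Mazur, PUB `p ≥ 5` split], (CTL) [Keller–Yin Thm. 7.0.6, PRE, +
Castella 2018 §2, PUB], (TAM) [vacuous]; the Tamagawa-over-`K` value. Conclusion: `BSDp W p`.
[claim: KellerYin2024, status: under-review] [cite: CastellaEtAl2021, Thm. 5.3.1]
[cite: Castella2018, §5 (5.1)–(5.3)] [cite: Miller2011LMS, Def. 1.1] -/
theorem bsdp_of_cellC_of_not_gvPar_of_shadowLinks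
    -- published facts for the rank-zero partner (sub-cell X2a) and the descent
    (hGV : lambdaMu_multiplicative_of_gvPar) (hWu : thm16_charIdeal_dvd_multiplicative_of_reducible)
    (hJs : thm61_splitMultiplicative) (hJn : thm61_nonsplitMultiplicative)
    (hHs : exists_isSplitMultCanonical) (hHn : exists_isMultCanonical)
    (hpar : nonempty_modularParametrizationData)
    (hGS : ∀ (W : WeierstrassCurve ℚ) [W.IsElliptic] [W.IsGloballyMinimal] (p : ℕ) [Fact p.Prime],
      greenberg_stevens (W := W) (p := p))
    (W : WeierstrassCurve ℚ) [W.IsElliptic] [W.IsGloballyMinimal] (p : ℕ) [Fact p.Prime]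
    (N : ℕ) [NeZero N] (K : Type) [Field K] [NumberField K]
    (Dt : ModularParametrizationData W N) (H : HeegnerDatum N (NumberField.discr K)) (ι : K →+* ℂ)
    (P : (W.baseChange K).toAffine.Point)
    (hGZ : gross_zagier N W K) (hKo : kolyvagin N W K)
    (hGZK : rank_eq_analyticRank_of_analyticRank_le_one) (hmod : hasEntireLFunction_rat)
    -- the pair and the Heegner data
    (hc : CellC W p) (hnot : ¬ GVPar W p) (hK : IsImaginaryQuadratic K)
    (hd4 : NumberField.discr K < -4) (hHN : SatisfiesHeegnerHypothesis N K)
    (hsplit : SatisfiesHeegnerHypothesis p K)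
    (hP : WeierstrassCurve.Affine.Point.map ι.toRatAlgHom P = heegnerPointComplex Dt H)
    (hcM : ¬ (p : ℤ) ∣ Dt.c)
    (hLt : (W.quadraticTwist (NumberField.discr K : ℚ)).entireLFunction 1 ≠ 0)
    -- a globally minimal model of the twist and the two decidable transport values
    (Wd : WeierstrassCurve ℚ) [Wd.IsElliptic] [Wd.IsGloballyMinimal] (Cd : VariableChange ℚ)
    (hWd : Cd • W.quadraticTwist (NumberField.discr K : ℚ) = Wd)
    (htam : padicValNat p Wd.tamagawaProduct = padicValNat p W.tamagawaProduct)
    (hu : padicValRat p (Cd.u : ℚ) = 0)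
    -- the Λ-adic shadow and its four links (IMC and CTL: Keller–Yin, PREPRINT; BDP, TAM: published)
    (S : X11b.LambdaAdicShadow W K P) (hIMC : S.IMCAtTrivialChar) (hBDP : S.WaldspurgerAt)
    (hCTL : S.ControlAt p) (hTAM : S.TamagawaAtRamifiedAt p)
    -- the Tamagawa-over-K transport value (all ℓ ∣ N split in K)
    (htamK : padicValNat p (W.baseChange K).tamagawaProduct = 2 * padicValNat p W.tamagawaProduct) :
    BSDp W p :=
  bsdp_of_cellC_of_not_gvPar_of_indexIdentityAt hGV hWu hJs hJn hHs hHn hpar hGS W p N K Dt H ι P hGZ hKo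
    hGZK hmod hc hnot hK hd4 hHN hsplit hP hcM hLt Wd Cd hWd htam hu
    (fun hfin => by
      haveI := hfin
      exact indexIdentityAt_of_shadowLinks p S hIMC hBDP hCTL hTAM htamK)

end Summit.BirchSwinnertonDyer.Rank1Residual.X2

end
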